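import Summits.QuantumFields.YangMills.Theorems.BalabanUVNodesN07Thm312PrintedRecPrOfEntryRows
import Literature.MathematicalPhysics.QuantumFieldTheory.Balaban1983to89.B3Taylor310LocalRemainder
import HarnessLib

/-!
# (3.129) AT THE FRAMED RECORD, KERNEL-CHECKED: the (3.133) entry rows of `H₁^{pr}(U₀) = G₁Q^{pr,*}(Q^{pr}G₁Q^{pr,*})⁻¹` FROM the Theorem 3.3-type entry rows of `G₁Q^{pr,*}` AND
# the (3.132) kernel rows of `(Q^{pr}G₁Q^{pr,*})⁻¹` — print p.423 «from (3.129) and (3.132) with G₁ instead of G we get the inequalities (3.133) for H₁», letter-generic, then row 20's display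

Cell `pub-ymgap` (HUMAN RULING D-0062, Track A), node N07 [B11] ∕ the K0ᴬ port wall; seat `pub-ymgap-dag-n06-l` (g43; N06 bundle F7 = [B9] Thms 3.12∕3.13 — row 20 `t312`).  The «(S-H) file 1»
LOCATED in this seat's g43 sizing note (pub-ymgap INBOX 2026-08-31 18:09Z): the (S) campaign's target at the framed record (✓`…N07Thm312PrintedRecPrOfEntryRows` §2 = the k-uniform (3.133) entry
rows of `H₁^{pr}(U₀)`) split into its TWO PRINTED SOURCES.  `--kind definition` (two readings + one kernel letter are `def`s) `--supports stmt-QuantumFields-27238 --as helper`; count-neutral.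
[B9] = [Balaban1985BackgroundPropagators]; [B11] = [Balaban1985Variational]; [4] = [Balaban1984PropagatorsII].

THE PRINTED LOCI.  [B9] (3.129) p.421 «H₁B = G₁Q*(QG₁Q*)⁻¹B»; (3.132) p.422 «|(QGQ*)⁻¹(y, y′)| ≤ O(1)(L^jη)⁻²(L^{j′}η)^{−d}e^{−δ₁d(y,y′)} … and the same for the operator with G₁ instead of G»;
p.422 «The above inequality together with Theorem 3.3 for G … give |H_{μν}(x, y′)|, |∇H_{μν}(x, y′)| … ≤ O(1)[1, (L^jη)⁻¹, …](L^{j′}η)^{−d}e^{−(1∕2)δ₁d(y,y′)} (3.133)»; p.423 «From (3.129) and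
(3.132) with G₁ instead of G we get the inequalities (3.133) for H₁»; [4] Lemma 2.1 (2.61) p.234 (the row sum).  At node 00 every class factor is `1` (unit blocks, `geoRecN00`).

WHAT IS HERE (standing data: `T : |·|₍₋₀₎ →L[ℂ] (115)` arbitrary, `S₀ : |·|₍₋₀₎ →L[ℂ] |·|₍₋₀₎` arbitrary; `d` = `Site.tdist` of the sources; dag-n07-e's ✓`colOp ∕ colOp1 ∕ entry0 ∕ entry1`):
* §1 `kerBlk S₀ y₁ y` — the kernel entry `X ↦ (S₀(δ_y X))(y₁) : V →L[ℂ] V` of a block operator; ★ `colOp_comp`, `colOp1_comp` — `colOpₙ (T ∘ S₀) y x = Σ_{y₁} colOpₙ T y₁ x ∘ kerBlk S₀ y₁ y` ((3.129)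
  column by column); `opNorm_colOp(1)_comp_le`; ★ `entry0_comp_le`, `entry1_comp_le` — `entryₙ (T ∘ S₀) y″ y ≤ Σ_{y₁} entryₙ T y″ y₁ · ‖kerBlk S₀ y₁ y‖`.
* §2 `exp_mul_exp_le_half_of_triangle`, `mul_expNeg_le_of_rate_le` (real bookkeeping); ★ `sum_decay_mul_decay_le` — THE (2.61) CONVOLUTION `Σ_{y₁} B_f e^{−ρd(y″,y₁)} B_g e^{−ρd(y₁,y)} ≤
  B_f B_g d(2(1+2∕ρ))^d e^{−(ρ∕2)d(y″,y)}` (torus triangle inequality ✓`B3Taylor310LocalRemainder.tdist_triangle` + ✓`rowSum_PBond_le` at rate `ρ∕2`); ★★ `entry0_comp_le_of_decay`,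
  `entry1_comp_le_of_decay` — decay rows of `T`'s entries and of `S₀`'s kernel ⟹ decay rows of `(T ∘ S₀)`'s entries at HALF the rate (print's `e^{−(1∕2)δ₁d}`).
* §3 `blockReadCLM φ C` — a Hilbert-level block operator `C : WL2 wB W →ₗ WL2 wB W` read as `|·|₍₋₀₎ →L[ℂ] |·|₍₋₀₎` (lit's `blockCLM115` pattern); ★ `H1CLM_comp` — lit's (115) reading of a
  Hilbert-level composite factors: `H1CLM φ (A ∘ C) = H1CLM φ A ∘ blockReadCLM φ C`.
* §4 (framed record pair `(Q^{pr}(U₀) = QprOfRecord … 𝔥, Q′(U₀) = QprimeOfRecord …)`, def-Y (A3) ✓`Node00.BgLettersPrOfRecord`): `g1QadjPrRead … hpos` = `G₁(U₀)Q^{pr,*}` read in (115) (lit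
  ✓`G1LatticeK hpos ∘ Q^{pr,†}`), `kinvPrRead … hpos hQ` = `(Q^{pr}G₁Q^{pr,*})⁻¹` read on the blocks (lit ✓`KinvLatticeK hpos hQ`); ★★ `H1prOfRecordAtBg_eq_comp` — (3.129) AS OPERATORS:
  `H1prOfRecordAtBg … = g1QadjPrRead … ∘ kinvPrRead …` (def-Y's letter unfolds to lit's `H1CLM φ (H1LatticeK hpos hQ)`, ✓`H1LatticeK_eq` is `rfl`, §3); ★★★ `h1pr_entryRows_of_parts` —
  ONE MEMBER ∕ ONE BACKGROUND: entry rows of `G₁Q^{pr,*}` (rate `ρ`, constant `B₁`) + kernel rows of `(Q^{pr}G₁Q^{pr,*})⁻¹` (rate `ρ`, constant `B₂`) ⟹ `entryₙ (H₁^{pr}(U₀)) y″ y ≤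
  B₁B₂·d(2(1+2∕ρ))^d·e^{−(ρ∕2)d(y″,y)}` (n = 0, 1).
* §5 ★★★ `thm312Printed_recPr_of_parts` — NODE-00, k-UNIFORM: the two letters as DISPLAYED family rows (constants before the member, own rates and regimes, the member's three
  positivity `Fact`s as binders, admissible `U₀ ∈ R35 ∩ R36`, displayed `hpos ∕ hQ`) ⟹ the `B9.Thm312Printed 4 c35 (geoRecN00 F) (bgRecN00 F N R35 R36) 0 0 H₁ᵖʳ H₁ᵖʳ ⊤ ⊤ ⊤` antecedent
  that dag-n07-e's (ℓa-H)ᵖʳ, this seat's (KL-H)ᵖʳ and PT-B's Prop. 4 door files read (via ✓`thm312Printed_recPr_of_entryRows`; rates merged by `min`, regimes by `max ∕ min`, `d = 4`).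
HONEST FRAMING.  What is PROVED is print's hence-step (3.129) + (3.132) + Thm 3.3 ⟹ (3.133) (sup members) at the framed record, node 00: finite sums, operator norms, the torus triangle
inequality, one geometric row sum.  The two source letters — Theorem 3.3-type entry rows of `G₁(U₀)Q^{pr,*}` and the (3.132) rows of `(Q^{pr}G₁Q^{pr,*})⁻¹`, k-uniform at the framed pair —
are DISPLAYED hypotheses, NOT proved here or anywhere in the tree (XL: [B9] Thm 3.3 ∕ (3.42) for `G₁ = (Δ₁ + DRD* + aQ*Q)⁻¹` at the framed pair, (3.130)–(3.132)); the Hölder member of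
(3.133) is not treated (it is `0 ≤ 0` at `geoRecN00`).  `R35 ∕ R36`, `𝔥`, `hpos ∕ hQ` displayed; K0ᴬ ⟨stmt-QuantumFields-27238⟩ NOT closed; K0ᴬ∕K1ᴬ∕K3ᴬ 0∕3; NODE O 0∕1; COUNT 8∕28 · K 1∕4
UNMOVED; finite `𝕋⁴_{L^K}` at fixed ε — NOT continuum ∕ ℝ⁴ ∕ OS; **the Yang–Mills mass gap (Clay) is NOT proved by any of this.**  No `sorry`, `instance`, `notation`, `set_option`;
standard axioms.
-/

noncomputable section

open scoped Matrix Matrix.Norms.L2Operator InnerProductSpace ComplexConjugate BigOperators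

namespace Summit.QuantumFields.YangMills.BalabanUVNodes.N07Thm312PrEntryRowsOfParts

open Literature.MathematicalPhysics.QuantumFieldTheory.Balaban1983to89
open Literature.MathematicalPhysics.QuantumFieldTheory.Balaban1983to89.Node00
open T4Continuum (T4Family)
open B9SectCLatticeCarrier (Bond)
open B11Eq115Space (NegSup NegSize Space115 JetSup levWeight)
open B11Eq111FrakG (nabla115)
open B11KernelDictionary (fsup le_fsup fsup_nonneg fsup_le)
open B3Taylor310LocalRemainder (tdist_triangle)
open Summit.QuantumFields.YangMills.BalabanUVNodes.N07Prop4LetterHOfThm312 (singleBIdx singleBIdx_apply sum_singleBIdx blkOfBond rowSum_PBond_le tdist_comm_rec)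
open Summit.QuantumFields.YangMills.BalabanUVNodes.N07KernelEntriesOfRecord (colOp colOp1 colOp_apply colOp1_apply eval_eq_sum_colOp nabla_eq_sum_colOp1 entry0 entry1
  opNorm_colOp_le_entry0 opNorm_colOp1_le_entry1)

/-! ## §1 The kernel of a block operator and the columns ∕ entries of a composite `T ∘ S₀` -/

section Generic

variable (F : T4Family) (N : ℕ) (K k : ℕ) (Ω : ℕ → Set (Site (F.P K) 0)) (U₀ : GaugeField (F.P K) 0 (SU N)) (levB : PBond (F.P K) k → ℕ)
variable [Fact (0 < (F.L : ℝ))] [Fact (0 < (F.P K).eta k)]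
variable (T : NegSize (F.L : ℝ) ((F.P K).eta k) levB 0 (Matrix (Fin N) (Fin N) ℂ) →L[ℂ] Space115Lit F N K k Ω U₀)
variable (S₀ : NegSize (F.L : ℝ) ((F.P K).eta k) levB 0 (Matrix (Fin N) (Fin N) ℂ) →L[ℂ] NegSize (F.L : ℝ) ((F.P K).eta k) levB 0 (Matrix (Fin N) (Fin N) ℂ))

/-- **THE KERNEL ENTRY `S₀(y₁, y)` OF A BLOCK OPERATOR** `S₀ : |·|₍₋₀₎ →L |·|₍₋₀₎` as a colour operator `X ↦ (S₀(δ_y X))(y₁) : V →L[ℂ] V` — print's `(QG₁Q*)⁻¹(y, y′)`.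
[cite: Balaban1985BackgroundPropagators, (3.132) p.422] -/
def kerBlk (y₁ y : PBond (F.P K) k) : Matrix (Fin N) (Fin N) ℂ →L[ℂ] Matrix (Fin N) (Fin N) ℂ :=
  LinearMap.toContinuousLinearMap ((NegSup.evalCLM ℂ (levWeight (F.L : ℝ) ((F.P K).eta k) levB 0) y₁).toLinearMap ∘ₗ S₀.toLinearMap ∘ₗ singleBIdx F N K k levB y)

/-- Unfolding `kerBlk`. [cite: Balaban1985BackgroundPropagators, (3.132) p.422 (bookkeeping)] -/
theorem kerBlk_apply (y₁ y : PBond (F.P K) k) (X : Matrix (Fin N) (Fin N) ℂ) :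
    kerBlk F N K k levB S₀ y₁ y X = NegSup.equiv _ _ (S₀ (singleBIdx F N K k levB y X)) y₁ := rfl

/-- **THE VALUE COLUMN OF A COMPOSITE**: `colOp (T ∘ S₀) y x = Σ_{y₁} colOp T y₁ x ∘ kerBlk S₀ y₁ y` (print's (3.129): `H₁(x, y′) = Σ_{y₁} (G₁Q*)(x, y₁)(QG₁Q*)⁻¹(y₁, y′)`).
[cite: Balaban1985BackgroundPropagators, (3.129) p.421, (3.133) p.422] -/
theorem colOp_comp (y : PBond (F.P K) k) (x : Bond (F.P K).d (fun _ => (F.P K).sitesPerDir 0)) :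
    colOp F N K k Ω U₀ levB (T.comp S₀) y x = ∑ y₁ : PBond (F.P K) k, (colOp F N K k Ω U₀ levB T y₁ x).comp (kerBlk F N K k levB S₀ y₁ y) := by
  refine ContinuousLinearMap.ext fun X => ?_
  rw [colOp_apply, ContinuousLinearMap.comp_apply, eval_eq_sum_colOp, FunLike.coe_sum, Finset.sum_apply]
  rfl

/-- **THE ∇-COLUMN OF A COMPOSITE**: `colOp1 (T ∘ S₀) y p = Σ_{y₁} colOp1 T y₁ p ∘ kerBlk S₀ y₁ y`. [cite: Balaban1985BackgroundPropagators, (3.129) p.421, (3.133) p.422] -/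
theorem colOp1_comp (y : PBond (F.P K) k) (p : Bond (F.P K).d (fun _ => (F.P K).sitesPerDir 0) × Fin (F.P K).d) :
    colOp1 F N K k Ω U₀ levB (T.comp S₀) y p = ∑ y₁ : PBond (F.P K) k, (colOp1 F N K k Ω U₀ levB T y₁ p).comp (kerBlk F N K k levB S₀ y₁ y) := by
  refine ContinuousLinearMap.ext fun X => ?_
  rw [colOp1_apply, ContinuousLinearMap.comp_apply, nabla_eq_sum_colOp1, FunLike.coe_sum, Finset.sum_apply]
  rfl

/-- `‖colOp (T ∘ S₀) y x‖ ≤ Σ_{y₁} ‖colOp T y₁ x‖·‖kerBlk S₀ y₁ y‖`. [cite: Balaban1985BackgroundPropagators, (3.129) p.421, (3.133) p.422] -/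
theorem opNorm_colOp_comp_le (y : PBond (F.P K) k) (x : Bond (F.P K).d (fun _ => (F.P K).sitesPerDir 0)) :
    ‖colOp F N K k Ω U₀ levB (T.comp S₀) y x‖ ≤ ∑ y₁ : PBond (F.P K) k, ‖colOp F N K k Ω U₀ levB T y₁ x‖ * ‖kerBlk F N K k levB S₀ y₁ y‖ := by
  rw [colOp_comp]
  exact (norm_sum_le _ _).trans (Finset.sum_le_sum fun y₁ _ =>
    ContinuousLinearMap.opNorm_comp_le (colOp F N K k Ω U₀ levB T y₁ x) (kerBlk F N K k levB S₀ y₁ y))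

/-- `‖colOp1 (T ∘ S₀) y p‖ ≤ Σ_{y₁} ‖colOp1 T y₁ p‖·‖kerBlk S₀ y₁ y‖`. [cite: Balaban1985BackgroundPropagators, (3.129) p.421, (3.133) p.422] -/
theorem opNorm_colOp1_comp_le (y : PBond (F.P K) k) (p : Bond (F.P K).d (fun _ => (F.P K).sitesPerDir 0) × Fin (F.P K).d) :
    ‖colOp1 F N K k Ω U₀ levB (T.comp S₀) y p‖ ≤ ∑ y₁ : PBond (F.P K) k, ‖colOp1 F N K k Ω U₀ levB T y₁ p‖ * ‖kerBlk F N K k levB S₀ y₁ y‖ := by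
  rw [colOp1_comp]
  exact (norm_sum_le _ _).trans (Finset.sum_le_sum fun y₁ _ =>
    ContinuousLinearMap.opNorm_comp_le (colOp1 F N K k Ω U₀ levB T y₁ p) (kerBlk F N K k levB S₀ y₁ y))

/-- ★ **THE ZEROTH ENTRY OF A COMPOSITE**: `entry0 (T ∘ S₀) y″ y ≤ Σ_{y₁} entry0 T y″ y₁ · ‖kerBlk S₀ y₁ y‖`. [cite: Balaban1985BackgroundPropagators, (3.129) p.421, (3.132)–(3.133) p.422] -/
theorem entry0_comp_le (y'' y : PBond (F.P K) k) :
    entry0 F N K k Ω U₀ levB (T.comp S₀) y'' y ≤ ∑ y₁ : PBond (F.P K) k, entry0 F N K k Ω U₀ levB T y'' y₁ * ‖kerBlk F N K k levB S₀ y₁ y‖ := by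
  classical
  have hS : 0 ≤ ∑ y₁ : PBond (F.P K) k, entry0 F N K k Ω U₀ levB T y'' y₁ * ‖kerBlk F N K k levB S₀ y₁ y‖ :=
    Finset.sum_nonneg fun y₁ _ => mul_nonneg (fsup_nonneg _) (norm_nonneg (kerBlk F N K k levB S₀ y₁ y))
  unfold entry0
  refine fsup_le hS fun x => ?_
  split_ifs with hx
  · subst hx
    exact (opNorm_colOp_comp_le F N K k Ω U₀ levB T S₀ y x).trans
      (Finset.sum_le_sum fun y₁ _ => mul_le_mul_of_nonneg_right (opNorm_colOp_le_entry0 F N K k Ω U₀ levB T y₁ x) (norm_nonneg (kerBlk F N K k levB S₀ y₁ y)))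
  · exact hS

/-- ★ **THE FIRST ENTRY OF A COMPOSITE**: `entry1 (T ∘ S₀) y″ y ≤ Σ_{y₁} entry1 T y″ y₁ · ‖kerBlk S₀ y₁ y‖`. [cite: Balaban1985BackgroundPropagators, (3.129) p.421, (3.132)–(3.133) p.422] -/
theorem entry1_comp_le (y'' y : PBond (F.P K) k) :
    entry1 F N K k Ω U₀ levB (T.comp S₀) y'' y ≤ ∑ y₁ : PBond (F.P K) k, entry1 F N K k Ω U₀ levB T y'' y₁ * ‖kerBlk F N K k levB S₀ y₁ y‖ := by
  classical
  have hS : 0 ≤ ∑ y₁ : PBond (F.P K) k, entry1 F N K k Ω U₀ levB T y'' y₁ * ‖kerBlk F N K k levB S₀ y₁ y‖ :=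
    Finset.sum_nonneg fun y₁ _ => mul_nonneg (fsup_nonneg _) (norm_nonneg (kerBlk F N K k levB S₀ y₁ y))
  unfold entry1
  refine fsup_le hS fun p => ?_
  split_ifs with hp
  · subst hp
    exact (opNorm_colOp1_comp_le F N K k Ω U₀ levB T S₀ y p).trans
      (Finset.sum_le_sum fun y₁ _ => mul_le_mul_of_nonneg_right (opNorm_colOp1_le_entry1 F N K k Ω U₀ levB T y₁ p) (norm_nonneg (kerBlk F N K k levB S₀ y₁ y)))
  · exact hS


/-! ## §2 The (2.61) convolution of two exponential decays; the entries of a composite from decay rows -/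

/-- `e^{−ρa}·e^{−ρb} ≤ e^{−(ρ∕2)c}·e^{−(ρ∕2)a}` when `c ≤ a + b` (`ρ, b ≥ 0`): half the rate pays the triangle inequality, the other half is kept for the row sum.
[cite: Balaban1985BackgroundPropagators, (3.133) p.422 («e^{−(1∕2)δ₁d(y,y′)}»); Balaban1984PropagatorsII, Lemma 2.1 p.234] -/
theorem exp_mul_exp_le_half_of_triangle {ρ a b c : ℝ} (hρ : 0 ≤ ρ) (hb : 0 ≤ b) (hc : c ≤ a + b) :
    Real.exp (-(ρ * a)) * Real.exp (-(ρ * b)) ≤ Real.exp (-(ρ / 2 * c)) * Real.exp (-(ρ / 2 * a)) := by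
  rw [← Real.exp_add, ← Real.exp_add]
  refine Real.exp_le_exp.2 ?_
  have h1 : ρ / 2 * c ≤ ρ / 2 * (a + b) := mul_le_mul_of_nonneg_left hc (by positivity)
  have h2 : 0 ≤ ρ * b := mul_nonneg hρ hb
  linarith

/-- A slower rate bounds a faster one: `B·e^{−δd} ≤ B·e^{−δ′d}` for `δ′ ≤ δ`, `d, B ≥ 0`. [cite: Balaban1985BackgroundPropagators, (3.132)–(3.133) p.422 (bookkeeping)] -/
theorem mul_expNeg_le_of_rate_le {B δ δ' t : ℝ} (hB : 0 ≤ B) (hδ : δ' ≤ δ) (ht : 0 ≤ t) :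
    B * Real.exp (-(δ * t)) ≤ B * Real.exp (-(δ' * t)) :=
  mul_le_mul_of_nonneg_left (Real.exp_le_exp.2 (by nlinarith [mul_le_mul_of_nonneg_right hδ ht])) hB

omit [Fact (0 < (F.L : ℝ))] [Fact (0 < (F.P K).eta k)] in
/-- ★ **THE (2.61) CONVOLUTION OVER THE B-INDEX**: if `0 ≤ f(y₁) ≤ B_f e^{−ρd(y″,y₁)}` and `0 ≤ g(y₁) ≤ B_g e^{−ρd(y₁,y)}` then
`Σ_{y₁} f(y₁)g(y₁) ≤ B_f B_g · d(2(1+2∕ρ))^d · e^{−(ρ∕2)d(y″,y)}` (triangle inequality on the record's torus + [4] (2.61) at rate `ρ∕2`).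
[cite: Balaban1984PropagatorsII, Lemma 2.1 (2.61) p.234; Balaban1985BackgroundPropagators, (3.133) p.422] -/
theorem sum_decay_mul_decay_le (y'' y : PBond (F.P K) k) {ρ Bf Bg : ℝ} (hρ : 0 < ρ) (hBf : 0 ≤ Bf) (hBg : 0 ≤ Bg) {f g : PBond (F.P K) k → ℝ}
    (hg0 : ∀ y₁, 0 ≤ g y₁) (hf : ∀ y₁, f y₁ ≤ Bf * Real.exp (-(ρ * (Site.tdist y''.src y₁.src : ℝ))))
    (hg : ∀ y₁, g y₁ ≤ Bg * Real.exp (-(ρ * (Site.tdist y₁.src y.src : ℝ)))) :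
    ∑ y₁ : PBond (F.P K) k, f y₁ * g y₁ ≤
      Bf * Bg * ((F.P K).d * (2 * (1 + 1 / (ρ / 2))) ^ (F.P K).d) * Real.exp (-(ρ / 2 * (Site.tdist y''.src y.src : ℝ))) := by
  have hterm : ∀ y₁ : PBond (F.P K) k, f y₁ * g y₁ ≤ Bf * Bg * Real.exp (-(ρ / 2 * (Site.tdist y''.src y.src : ℝ))) *
      Real.exp (-(ρ / 2 * (Site.tdist y''.src y₁.src : ℝ))) := by
    intro y₁
    have htri : (Site.tdist y''.src y.src : ℝ) ≤ (Site.tdist y''.src y₁.src : ℝ) + (Site.tdist y₁.src y.src : ℝ) := by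
      exact_mod_cast tdist_triangle y''.src y₁.src y.src
    calc f y₁ * g y₁
        ≤ (Bf * Real.exp (-(ρ * (Site.tdist y''.src y₁.src : ℝ)))) * (Bg * Real.exp (-(ρ * (Site.tdist y₁.src y.src : ℝ)))) :=
          mul_le_mul (hf y₁) (hg y₁) (hg0 y₁) (mul_nonneg hBf (Real.exp_nonneg _))
      _ = Bf * Bg * (Real.exp (-(ρ * (Site.tdist y''.src y₁.src : ℝ))) * Real.exp (-(ρ * (Site.tdist y₁.src y.src : ℝ)))) := by ring
      _ ≤ Bf * Bg * (Real.exp (-(ρ / 2 * (Site.tdist y''.src y.src : ℝ))) * Real.exp (-(ρ / 2 * (Site.tdist y''.src y₁.src : ℝ)))) :=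
          mul_le_mul_of_nonneg_left (exp_mul_exp_le_half_of_triangle hρ.le (Nat.cast_nonneg _) htri) (mul_nonneg hBf hBg)
      _ = _ := by ring
  calc ∑ y₁ : PBond (F.P K) k, f y₁ * g y₁
      ≤ ∑ y₁ : PBond (F.P K) k, Bf * Bg * Real.exp (-(ρ / 2 * (Site.tdist y''.src y.src : ℝ))) * Real.exp (-(ρ / 2 * (Site.tdist y''.src y₁.src : ℝ))) :=
        Finset.sum_le_sum fun y₁ _ => hterm y₁
    _ = Bf * Bg * Real.exp (-(ρ / 2 * (Site.tdist y''.src y.src : ℝ))) * ∑ y₁ : PBond (F.P K) k, Real.exp (-(ρ / 2 * (Site.tdist y''.src y₁.src : ℝ))) := by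
        rw [Finset.mul_sum]
    _ ≤ Bf * Bg * Real.exp (-(ρ / 2 * (Site.tdist y''.src y.src : ℝ))) * ((F.P K).d * (2 * (1 + 1 / (ρ / 2))) ^ (F.P K).d) :=
        mul_le_mul_of_nonneg_left (rowSum_PBond_le F K k y'' (half_pos hρ)) (by positivity)
    _ = _ := by ring

/-- ★★ **THE ZEROTH ENTRY ROW OF A COMPOSITE FROM THE TWO DECAY ROWS** — print's «(3.132) together with Theorem 3.3 give (3.133)» for the value entries:
`entry0 T y″ y₁ ≤ B_T e^{−ρd}`, `‖S₀(y₁, y)‖ ≤ B_S e^{−ρd}` ⟹ `entry0 (T ∘ S₀) y″ y ≤ B_T B_S d(2(1+2∕ρ))^d e^{−(ρ∕2)d(y″,y)}`.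
[cite: Balaban1985BackgroundPropagators, (3.129) p.421, (3.132)–(3.133) p.422, p.423; Balaban1984PropagatorsII, (2.61) p.234] -/
theorem entry0_comp_le_of_decay {ρ BT BS : ℝ} (hρ : 0 < ρ) (hBT : 0 ≤ BT) (hBS : 0 ≤ BS)
    (hT : ∀ y'' y₁ : PBond (F.P K) k, entry0 F N K k Ω U₀ levB T y'' y₁ ≤ BT * Real.exp (-(ρ * (Site.tdist y''.src y₁.src : ℝ))))
    (hS : ∀ y₁ y : PBond (F.P K) k, ‖kerBlk F N K k levB S₀ y₁ y‖ ≤ BS * Real.exp (-(ρ * (Site.tdist y₁.src y.src : ℝ)))) (y'' y : PBond (F.P K) k) :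
    entry0 F N K k Ω U₀ levB (T.comp S₀) y'' y ≤
      BT * BS * ((F.P K).d * (2 * (1 + 1 / (ρ / 2))) ^ (F.P K).d) * Real.exp (-(ρ / 2 * (Site.tdist y''.src y.src : ℝ))) :=
  (entry0_comp_le F N K k Ω U₀ levB T S₀ y'' y).trans
    (sum_decay_mul_decay_le F K k y'' y hρ hBT hBS (fun y₁ => norm_nonneg (kerBlk F N K k levB S₀ y₁ y)) (hT y'') fun y₁ => hS y₁ y)

/-- ★★ **THE FIRST ENTRY ROW OF A COMPOSITE FROM THE TWO DECAY ROWS** (the `∇` entries). [cite: Balaban1985BackgroundPropagators, (3.129) p.421, (3.132)–(3.133) p.422, p.423; Balaban1984PropagatorsII, (2.61) p.234] -/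
theorem entry1_comp_le_of_decay {ρ BT BS : ℝ} (hρ : 0 < ρ) (hBT : 0 ≤ BT) (hBS : 0 ≤ BS)
    (hT : ∀ y'' y₁ : PBond (F.P K) k, entry1 F N K k Ω U₀ levB T y'' y₁ ≤ BT * Real.exp (-(ρ * (Site.tdist y''.src y₁.src : ℝ))))
    (hS : ∀ y₁ y : PBond (F.P K) k, ‖kerBlk F N K k levB S₀ y₁ y‖ ≤ BS * Real.exp (-(ρ * (Site.tdist y₁.src y.src : ℝ)))) (y'' y : PBond (F.P K) k) :
    entry1 F N K k Ω U₀ levB (T.comp S₀) y'' y ≤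
      BT * BS * ((F.P K).d * (2 * (1 + 1 / (ρ / 2))) ^ (F.P K).d) * Real.exp (-(ρ / 2 * (Site.tdist y''.src y.src : ℝ))) :=
  (entry1_comp_le F N K k Ω U₀ levB T S₀ y'' y).trans
    (sum_decay_mul_decay_le F K k y'' y hρ hBT hBS (fun y₁ => norm_nonneg (kerBlk F N K k levB S₀ y₁ y)) (hT y'') fun y₁ => hS y₁ y)

end Generic

/-! ## §3 A Hilbert-level composite `A ∘ C` read in (115) factors through the block reading of `C` -/

section Reading

open B11Eq103H1Complex (funEquiv readFun readFun_apply H1CLM)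
open B9Eq311L2Pairing (WL2)

variable {ι β κ : Type*} [Fintype ι] [Fintype β] [Fintype κ] {V : Type*} [NormedAddCommGroup V] [NormedSpace ℂ V] [FiniteDimensional ℂ V]
  {L η : ℝ} [Fact (0 < L)] [Fact (0 < η)] {lev₀ : ι → ℕ} {levB : β → ℕ}
  {W : Type*} [NormedAddCommGroup W] [InnerProductSpace ℂ W] (φ : W ≃ₗ[ℂ] V) {wι : ι → ℝ} {wB : β → ℝ}

/-- **A HILBERT-LEVEL BLOCK OPERATOR READ ON THE BLOCK FIELDS**: `C : WL2 wB W →ₗ WL2 wB W` (e.g. `(QG₁Q*)⁻¹ = KinvLatticeK …`) as `|·|₍₋₀₎ →L[ℂ] |·|₍₋₀₎` along the fibre map `φ`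
(continuity automatic on the finite lattice) — the block-field analogue of lit's `blockCLM115`. [cite: Balaban1985Variational, (45) p.285, (103) p.293; Balaban1985BackgroundPropagators, (3.132) p.422] -/
def blockReadCLM (C : WL2 ℂ wB W →ₗ[ℂ] WL2 ℂ wB W) : NegSize L η levB 0 V →L[ℂ] NegSize L η levB 0 V :=
  LinearMap.toContinuousLinearMap
    ((NegSup.linearEquiv ℂ (levWeight L η levB 0) : NegSize L η levB 0 V ≃ₗ[ℂ] (β → V)).symm.toLinearMap ∘ₗ readFun φ wB wB C ∘ₗ
      (NegSup.linearEquiv ℂ (levWeight L η levB 0) : NegSize L η levB 0 V ≃ₗ[ℂ] (β → V)).toLinearMap)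

/-- Unfolding: the block function underlying `blockReadCLM φ C B` is `C` read on the functions, applied to the block function of `B`. [cite: Balaban1985Variational, (103) p.293 (bookkeeping)] -/
theorem blockReadCLM_apply (C : WL2 ℂ wB W →ₗ[ℂ] WL2 ℂ wB W) (B : NegSize L η levB 0 V) :
    NegSup.equiv _ V (blockReadCLM (L := L) (η := η) (levB := levB) φ C B) = readFun φ wB wB C (NegSup.equiv _ V B) := rfl

/-- ★ **(3.129) AS OPERATORS IN THE (115) READING**: `H1CLM φ (A ∘ C) = H1CLM φ A ∘ blockReadCLM φ C` — a Hilbert-level composite read in (115) IS the composite of the (115) reading of `A`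
with the block reading of `C`. [cite: Balaban1985BackgroundPropagators, (3.129) p.421; Balaban1985Variational, (103) p.293] -/
theorem H1CLM_comp (lev₁ : κ → ℕ) (Dc : (ι → V) →ₗ[ℂ] (κ → V)) (A : WL2 ℂ wB W →ₗ[ℂ] WL2 ℂ wι W) (C : WL2 ℂ wB W →ₗ[ℂ] WL2 ℂ wB W) :
    H1CLM (L := L) (η := η) (lev₀ := lev₀) (levB := levB) φ lev₁ Dc (A ∘ₗ C) =
      (H1CLM (L := L) (η := η) (lev₀ := lev₀) φ lev₁ Dc A).comp (blockReadCLM (L := L) (η := η) (levB := levB) φ C) := by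
  refine ContinuousLinearMap.ext fun B => (JetSup.equiv _ _ Dc).injective ?_
  show readFun φ wB wι (A ∘ₗ C) (NegSup.equiv _ V B) = readFun φ wB wι A (readFun φ wB wB C (NegSup.equiv _ V B))
  simp only [readFun_apply, LinearMap.comp_apply, LinearEquiv.symm_apply_apply]

end Reading

/-! ## §4 At the framed record: `H₁^{pr}(U₀) = (G₁Q^{pr,*} read in (115)) ∘ ((Q^{pr}G₁Q^{pr,*})⁻¹ read on the blocks)`, and the (3.133) rows of `H₁^{pr}` from the two letters -/

section Record

open B11Eq103H1Complex (H1CLM G1LatticeK KinvLatticeK H1LatticeK H1LatticeK_eq H1LatticeCLM)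
open Summit.QuantumFields.YangMills.BalabanUVNodes.N07Prop4LetterHOfThm312 (MemberN00 bgRecN00 geoRecN00)
open Summit.QuantumFields.YangMills.BalabanUVNodes.N07FramedLettersOfThm312313 (h1KernelRecPrN00)
open Summit.QuantumFields.YangMills.BalabanUVNodes.N07Thm312PrintedRecPrOfEntryRows (thm312Printed_recPr_of_entryRows)

variable (F : T4Family) (N : ℕ) [NeZero N] (K k : ℕ) (Ω : ℕ → Set (Site (F.P K) 0)) (U₀ : GaugeField (F.P K) 0 (SU N))
variable [Fact (0 < (F.L : ℝ))] [Fact (0 < (F.P K).eta k)] [Fact (0 < c0Rec F K k)] [Fact (∀ c, 0 < wBRec F K k c)]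

/-- **`G₁(U₀)Q^{pr,*}` READ IN (115)** at the framed pair `(Q^{pr}(U₀), Q′(U₀))`: the Hilbert-level `G1LatticeK hpos ∘ Q^{pr,†}` (lit, constructed) in the type `|·|₍₋₀₎ →L[ℂ] (115)` — the LEFT factor
of (3.129); its entries are what [B9] Theorem 3.3 (for `G₁`, summed over the averaging blocks) controls.  A reading, nothing asserted.
[cite: Balaban1985BackgroundPropagators, (3.129) p.421, Thm 3.3 (3.42) p.397; Balaban1985Variational, (103) p.293, (110) p.294] -/
def g1QadjPrRead (𝔥 : FrameDatum (F.P K) N k U₀) (levB : PBond (F.P K) k → ℕ) (a : ℝ)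
    (hpos : ∀ x, x ≠ 0 → 0 < RCLike.re ⟪x, laplaceAOfRecord F N k U₀ (QprOfRecord F N k U₀ 𝔥) (QprimeOfRecord F N k U₀) a x⟫_ℂ) :
    NegSize (F.L : ℝ) ((F.P K).eta k) levB 0 (Matrix (Fin N) (Fin N) ℂ) →L[ℂ] Space115Lit F N K k Ω U₀ :=
  H1CLM (L := (F.L : ℝ)) (η := (F.P K).eta k) (lev₀ := bondLevLit F Ω k) (levB := levB) (phiRec N) (pairLevLit F Ω k)
    (nabla115 ((F.P K).eta k) (unitsOfRecord F N U₀)) (G1LatticeK hpos ∘ₗ LinearMap.adjoint (QprOfRecord F N k U₀ 𝔥))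

/-- **`(Q^{pr}G₁Q^{pr,*})⁻¹` READ ON THE BLOCK FIELDS** at the framed pair: lit's constructed `KinvLatticeK hpos hQ` as `|·|₍₋₀₎ →L[ℂ] |·|₍₋₀₎` — the RIGHT factor of (3.129); its kernel
`kerBlk … y₁ y` is print's `(QG₁Q*)⁻¹(y, y′)` of (3.132).  A reading, nothing asserted. [cite: Balaban1985BackgroundPropagators, (3.129) p.421, (3.132) p.422; Balaban1985Variational, (45) p.285] -/
def kinvPrRead (𝔥 : FrameDatum (F.P K) N k U₀) (levB : PBond (F.P K) k → ℕ) (a : ℝ)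
    (hpos : ∀ x, x ≠ 0 → 0 < RCLike.re ⟪x, laplaceAOfRecord F N k U₀ (QprOfRecord F N k U₀ 𝔥) (QprimeOfRecord F N k U₀) a x⟫_ℂ)
    (hQ : Function.Surjective (QprOfRecord F N k U₀ 𝔥)) :
    NegSize (F.L : ℝ) ((F.P K).eta k) levB 0 (Matrix (Fin N) (Fin N) ℂ) →L[ℂ] NegSize (F.L : ℝ) ((F.P K).eta k) levB 0 (Matrix (Fin N) (Fin N) ℂ) :=
  blockReadCLM (L := (F.L : ℝ)) (η := (F.P K).eta k) (levB := levB) (phiRec N) (KinvLatticeK hpos hQ)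

/-- ★★ **(3.129) AT THE FRAMED RECORD, AS OPERATORS**: `H₁^{pr}(U₀) = (G₁Q^{pr,*} in (115)) ∘ ((Q^{pr}G₁Q^{pr,*})⁻¹ on the blocks)` — def-Y's `H1prOfRecordAtBg` unfolds to lit's `H1CLM φ (H1LatticeK hpos hQ)`,
`H1LatticeK = G₁ ∘ Q† ∘ K⁻¹` (`rfl`), and §3. [cite: Balaban1985BackgroundPropagators, (3.129) p.421; Balaban1985Variational, (45) p.285, (103) p.293] -/
theorem H1prOfRecordAtBg_eq_comp (𝔥 : FrameDatum (F.P K) N k U₀) (levB : PBond (F.P K) k → ℕ) (a : ℝ)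
    (hpos : ∀ x, x ≠ 0 → 0 < RCLike.re ⟪x, laplaceAOfRecord F N k U₀ (QprOfRecord F N k U₀ 𝔥) (QprimeOfRecord F N k U₀) a x⟫_ℂ)
    (hQ : Function.Surjective (QprOfRecord F N k U₀ 𝔥)) :
    H1prOfRecordAtBg F N K k Ω U₀ 𝔥 levB a hpos hQ = (g1QadjPrRead F N K k Ω U₀ 𝔥 levB a hpos).comp (kinvPrRead F N K k U₀ 𝔥 levB a hpos hQ) := by
  unfold H1prOfRecordAtBg H1OfRecord H1LatticeCLM g1QadjPrRead kinvPrRead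
  rw [H1LatticeK_eq, ← LinearMap.comp_assoc]
  exact H1CLM_comp (phiRec N) (pairLevLit F Ω k) (nabla115 ((F.P K).eta k) (unitsOfRecord F N U₀)) _ _

/-- ★★★ **THE (3.133) ENTRY ROWS OF `H₁^{pr}(U₀)` FROM THE TWO LETTERS, ONE MEMBER ∕ ONE BACKGROUND** — print p.423 «from (3.129) and (3.132) with G₁ instead of G we get the inequalities
(3.133) for H₁», at the framed record pair and node-00 (unit blocks): entry rows of `G₁Q^{pr,*}` at rate `ρ`, constant `B₁` (Theorem 3.3-type) and kernel rows of `(Q^{pr}G₁Q^{pr,*})⁻¹` at rate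
`ρ`, constant `B₂` ((3.132)-type) ⟹ `entryₙ (H₁^{pr}(U₀)) y″ y ≤ B₁B₂·d(2(1+2∕ρ))^d·e^{−(ρ∕2)d(y″,y)}` (n = 0, 1) — print's halved rate `e^{−(1∕2)δ₁d}`.
[cite: Balaban1985BackgroundPropagators, Thm 3.12 pp.421–423, (3.129) p.421, (3.132)–(3.133) p.422; Balaban1984PropagatorsII, Lemma 2.1 (2.61) p.234] -/
theorem h1pr_entryRows_of_parts (𝔥 : FrameDatum (F.P K) N k U₀) (levB : PBond (F.P K) k → ℕ) (a : ℝ)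
    (hpos : ∀ x, x ≠ 0 → 0 < RCLike.re ⟪x, laplaceAOfRecord F N k U₀ (QprOfRecord F N k U₀ 𝔥) (QprimeOfRecord F N k U₀) a x⟫_ℂ)
    (hQ : Function.Surjective (QprOfRecord F N k U₀ 𝔥)) {ρ B₁ B₂ : ℝ} (hρ : 0 < ρ) (hB₁ : 0 ≤ B₁) (hB₂ : 0 ≤ B₂)
    (hG0 : ∀ y'' y₁ : PBond (F.P K) k, entry0 F N K k Ω U₀ levB (g1QadjPrRead F N K k Ω U₀ 𝔥 levB a hpos) y'' y₁ ≤ B₁ * Real.exp (-(ρ * (Site.tdist y''.src y₁.src : ℝ))))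
    (hG1 : ∀ y'' y₁ : PBond (F.P K) k, entry1 F N K k Ω U₀ levB (g1QadjPrRead F N K k Ω U₀ 𝔥 levB a hpos) y'' y₁ ≤ B₁ * Real.exp (-(ρ * (Site.tdist y''.src y₁.src : ℝ))))
    (hKi : ∀ y₁ y : PBond (F.P K) k, ‖kerBlk F N K k levB (kinvPrRead F N K k U₀ 𝔥 levB a hpos hQ) y₁ y‖ ≤ B₂ * Real.exp (-(ρ * (Site.tdist y₁.src y.src : ℝ))))
    (y'' y : PBond (F.P K) k) :
    entry0 F N K k Ω U₀ levB (H1prOfRecordAtBg F N K k Ω U₀ 𝔥 levB a hpos hQ) y'' y ≤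
        B₁ * B₂ * ((F.P K).d * (2 * (1 + 1 / (ρ / 2))) ^ (F.P K).d) * Real.exp (-(ρ / 2 * (Site.tdist y''.src y.src : ℝ))) ∧
      entry1 F N K k Ω U₀ levB (H1prOfRecordAtBg F N K k Ω U₀ 𝔥 levB a hpos hQ) y'' y ≤
        B₁ * B₂ * ((F.P K).d * (2 * (1 + 1 / (ρ / 2))) ^ (F.P K).d) * Real.exp (-(ρ / 2 * (Site.tdist y''.src y.src : ℝ))) := by
  rw [H1prOfRecordAtBg_eq_comp]
  exact ⟨entry0_comp_le_of_decay F N K k Ω U₀ levB _ _ hρ hB₁ hB₂ hG0 hKi y'' y, entry1_comp_le_of_decay F N K k Ω U₀ levB _ _ hρ hB₁ hB₂ hG1 hKi y'' y⟩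

end Record

/-! ## §5 Node-00, k-uniform: the displayed `B9.Thm312Printed … (h1KernelRecPrN00 …)` antecedent of (ℓa-H)ᵖʳ ∕ (KL-H)ᵖʳ from the two primitive letters -/

section Family

open Summit.QuantumFields.YangMills.BalabanUVNodes.N07Prop4LetterHOfThm312 (MemberN00 bgRecN00 geoRecN00)
open Summit.QuantumFields.YangMills.BalabanUVNodes.N07FramedLettersOfThm312313 (h1KernelRecPrN00)
open Summit.QuantumFields.YangMills.BalabanUVNodes.N07Thm312PrintedRecPrOfEntryRows (thm312Printed_recPr_of_entryRows)

variable (F : T4Family) (N : ℕ) [NeZero N] (a : ℝ)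

/-- ★★★ **ROW 20'S DISPLAYED ANTECEDENT FROM THE TWO PRIMITIVE LETTERS (node-00, k-uniform)** — the `B9.Thm312Printed 4 c35 (geoRecN00 F) (bgRecN00 F N R35 R36) 0 0 H₁ᵖʳ H₁ᵖʳ ⊤ ⊤ ⊤`
display read by dag-n07-e's ✓`prop4LetterHPrAtRecord_of_thm312Printed`, this seat's ✓`klH_of_thm312PrintedPr` and PT-B's door files FOLLOWS from two k-uniform rows at the framed record pair,
each with its constants bound BEFORE the member: (G) Theorem 3.3-type entry rows of `G₁(U₀)Q^{pr,*}` read in (115) — `entryₙ (g1QadjPrRead …) y″ y₁ ≤ B₁e^{−δ₁d(y″,y₁)}` (n = 0, 1) at every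
member `i` (`M₄ ≤ Mc_i`), `0 < α₀` (`Mc_i·α₀ ≤ a₀`), admissible `U₀ ∈ R35 ∩ R36 (i c35 α₀)` and displayed `hpos`; (K) the (3.132) kernel rows of `(Q^{pr}G₁Q^{pr,*})⁻¹` —
`‖kerBlk (kinvPrRead …) y₁ y‖ ≤ B₂e^{−δ₁′d(y₁,y)}` likewise (displayed `hpos hQ`).  Inside: rates merged to `δ₀ := min δ₁ δ₁′`, regimes to `max M₄ ∕ min a₀`, then §4 at every member
(`B₀ := B₁B₂·4(2(1+2∕δ₀))⁴`, rate `δ₀∕2` — print's `e^{−(1∕2)δ₁d}`), then ✓`thm312Printed_recPr_of_entryRows`.  The two letters (G), (K) are NOT proved here (XL; [B9] Thm 3.3 for `G₁` at the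
framed pair + block sums, and (3.130)–(3.132)); they replace the single displayed (3.133) row of record by its two printed sources.
[cite: Balaban1985BackgroundPropagators, Thm 3.12 pp.421–423, (3.129) p.421, (3.132)–(3.133) p.422, Thm 3.3 (3.42) p.397; Balaban1984PropagatorsII, Lemma 2.1 (2.61) p.234; Balaban1985Variational, (45)–(46) p.285] -/
theorem thm312Printed_recPr_of_parts [Fact (0 < (F.L : ℝ))] {c35 : ℝ}
    {R35 R36 : ∀ i : MemberN00 F, ℝ → ℝ → GaugeField (F.P i.K) 0 (SU N) → Prop}
    {𝔥 : ∀ i : MemberN00 F, (U₀ : GaugeField (F.P i.K) 0 (SU N)) → FrameDatum (F.P i.K) N i.k U₀}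
    (hG : ∃ M₄ δ₁ a₀ B₁ : ℝ, 0 < M₄ ∧ 0 < δ₁ ∧ 0 < a₀ ∧ 0 < B₁ ∧
      ∀ i : MemberN00 F, M₄ ≤ (i.Mc : ℝ) → ∀ α₀ : ℝ, 0 < α₀ → (i.Mc : ℝ) * α₀ ≤ a₀ →
        ∀ [Fact (0 < (F.P i.K).eta i.k)] [Fact (0 < c0Rec F i.K i.k)] [Fact (∀ c, 0 < wBRec F i.K i.k c)],
        ∀ U₀ : GaugeField (F.P i.K) 0 (SU N), R35 i c35 α₀ U₀ → R36 i c35 α₀ U₀ →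
          ∀ (hpos : ∀ x, x ≠ 0 → 0 < RCLike.re ⟪x, laplaceAOfRecord F N i.k U₀ (QprOfRecord F N i.k U₀ (𝔥 i U₀)) (QprimeOfRecord F N i.k U₀) a x⟫_ℂ)
            (y'' y₁ : PBond (F.P i.K) i.k),
            entry0 F N i.K i.k i.Ω U₀ i.levB (g1QadjPrRead F N i.K i.k i.Ω U₀ (𝔥 i U₀) i.levB a hpos) y'' y₁ ≤
                B₁ * Real.exp (-(δ₁ * (Site.tdist y''.src y₁.src : ℝ))) ∧
            entry1 F N i.K i.k i.Ω U₀ i.levB (g1QadjPrRead F N i.K i.k i.Ω U₀ (𝔥 i U₀) i.levB a hpos) y'' y₁ ≤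
                B₁ * Real.exp (-(δ₁ * (Site.tdist y''.src y₁.src : ℝ))))
    (hKi : ∃ M₄ δ₁ a₀ B₂ : ℝ, 0 < M₄ ∧ 0 < δ₁ ∧ 0 < a₀ ∧ 0 < B₂ ∧
      ∀ i : MemberN00 F, M₄ ≤ (i.Mc : ℝ) → ∀ α₀ : ℝ, 0 < α₀ → (i.Mc : ℝ) * α₀ ≤ a₀ →
        ∀ [Fact (0 < (F.P i.K).eta i.k)] [Fact (0 < c0Rec F i.K i.k)] [Fact (∀ c, 0 < wBRec F i.K i.k c)],
        ∀ U₀ : GaugeField (F.P i.K) 0 (SU N), R35 i c35 α₀ U₀ → R36 i c35 α₀ U₀ →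
          ∀ (hpos : ∀ x, x ≠ 0 → 0 < RCLike.re ⟪x, laplaceAOfRecord F N i.k U₀ (QprOfRecord F N i.k U₀ (𝔥 i U₀)) (QprimeOfRecord F N i.k U₀) a x⟫_ℂ)
            (hQ : Function.Surjective (QprOfRecord F N i.k U₀ (𝔥 i U₀))) (y₁ y : PBond (F.P i.K) i.k),
            ‖kerBlk F N i.K i.k i.levB (kinvPrRead F N i.K i.k U₀ (𝔥 i U₀) i.levB a hpos hQ) y₁ y‖ ≤
                B₂ * Real.exp (-(δ₁ * (Site.tdist y₁.src y.src : ℝ)))) :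
    B9.Thm312Printed 4 c35 (geoRecN00 F) (bgRecN00 F N R35 R36) (fun _ => ⟨0, 0, 0, 0, 0, 0⟩) (fun _ => ⟨0, 0, 0, 0, 0, 0⟩)
      (h1KernelRecPrN00 F N a R35 R36 𝔥) (h1KernelRecPrN00 F N a R35 R36 𝔥)
      (fun _ _ _ _ => True) (fun _ _ _ _ => True) (fun _ _ _ => True) := by
  obtain ⟨MG, δG, aG, BG, hMG, hδG, haG, hBG, hG⟩ := hG
  obtain ⟨MK, δK, aK, BK, hMK, hδK, haK, hBK, hK⟩ := hKi
  have hδ₀ : 0 < min δG δK := lt_min hδG hδK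
  have hB₀ : 0 < BG * BK * (4 * (2 * (1 + 1 / (min δG δK / 2))) ^ 4) := by positivity
  refine thm312Printed_recPr_of_entryRows F N a ⟨max MG MK, min δG δK, min aG aK, BG * BK * (4 * (2 * (1 + 1 / (min δG δK / 2))) ^ 4),
    lt_max_of_lt_left hMG, hδ₀, lt_min haG haK, hB₀, fun i hM α₀ hα₀ hMa => ?_⟩
  intro _ _ _ U₀ h35 h36 hpos hQ y y'
  have hGi := hG i ((le_max_left _ _).trans hM) α₀ hα₀ (hMa.trans (min_le_left _ _)) U₀ h35 h36 hpos
  have hKi := hK i ((le_max_right _ _).trans hM) α₀ hα₀ (hMa.trans (min_le_right _ _)) U₀ h35 h36 hpos hQ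
  have h := h1pr_entryRows_of_parts F N i.K i.k i.Ω U₀ (𝔥 i U₀) i.levB a hpos hQ hδ₀ hBG.le hBK.le
    (fun y'' y₁ => (hGi y'' y₁).1.trans (mul_expNeg_le_of_rate_le hBG.le (min_le_left _ _) (Nat.cast_nonneg _)))
    (fun y'' y₁ => (hGi y'' y₁).2.trans (mul_expNeg_le_of_rate_le hBG.le (min_le_left _ _) (Nat.cast_nonneg _)))
    (fun y₁ y₀ => (hKi y₁ y₀).trans (mul_expNeg_le_of_rate_le hBK.le (min_le_right _ _) (Nat.cast_nonneg _))) y y'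
  simpa only [T4Family.P_d, Nat.cast_ofNat] using h

end Family


end Summit.QuantumFields.YangMills.BalabanUVNodes.N07Thm312PrEntryRowsOfParts

end
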